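import Summits.Ventures.LatticeQCDFlow.Scoring.SU2TorusPlaquetteSquareFiniteVolume
import Summits.Ventures.LatticeQCDFlow.Scoring.SU2TorusPlaquettePairFiniteVolume
import HarnessLib

/-!
# SU(2) on the 2-torus: THE ERROR-BAR ORACLE — `Var(P̄) = v(β)/L² + O(r^{L²−2})` for the volume-averaged plaquette

HONEST FRAMING: exact (Metropolis-corrected) sampling algorithms for lattice gauge theory;
figures of merit are autocorrelation/cost numbers at stated couplings and volumes; no
continuum-physics claim.

Venture `LatticeQCDFlow` (cell pub-lqcd), sub-topic `Scoring`; FANOUT row 5 (`s0-sun-a`), GEN-12.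
NEW WORK of the cell (placement rule); assembles `SU2TorusPlaquetteSquareFiniteVolume` (single-plaquette
variance `v(β) + O(r^{L²−1})`) and `SU2TorusPlaquettePairFiniteVolume` (pair covariances `O(r^{L²−2})`) into the
variance of the observable the samplers actually report, the volume-averaged plaquette
`P̄ = L⁻² Σ_x ½ tr U_x` on `(ℤ/L)²`:

* **`abs_variance_su2a0_plaquetteAverage_two_sub_le`** — for `β > 0` and `L ≥ 2`:
  `|Var_{(ℤ/L)²,β}(P̄) − v(β)/L²| ≤ (I₂(2β)/I₁(2β))^{L²−2}·(15/16 + (29/4) Σ_n I_{n+2}(2β)/I₁(2β))`,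
  `v(β) = ¼(1 + 3 I₃(2β)/I₁(2β)) − (I₂(2β)/I₁(2β))²`, `Var(F) = ⟨F²⟩ − ⟨F⟩²`;
* `tendsto_sq_mul_variance_su2a0_plaquetteAverage_two` — `L²·Var(P̄) → v(β)` as `L → ∞`.

READING (the error-bar oracle of the S0 acceptance test 'plaquette within 2σ of exact'): under the exact measure
the `L²` plaquettes of a configuration are uncorrelated to `O(r^{L²−2})` (`< 10⁻⁸³` at `16²`, `b = 2.2`), so an ideal
sampler returning `N` independent configurations estimates `⟨½ tr U_p⟩` with standard error `√(v(β)/(L² N))`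
(up to that correction); a sampler's effective sample size for the plaquette is `v(β)/(L² N σ̂²)` with `σ̂` its
own error bar.  Nothing is cited; no `def`.
-/

noncomputable section

open Real MeasureTheory Set Function Finset Filter Topology Polynomial.Chebyshev
open Literature.MathematicalPhysics.QuantumFieldTheory Literature.MathematicalPhysics.QuantumLattice
open Literature.Analysis.FunctionSpaces
open Summit.Ventures.LatticeQCDFlow.Exactness
open Summit.Ventures.LatticeQCDFlow.Theory2.Lattice

namespace Summit.Ventures.LatticeQCDFlow.Scoring

/-- A double sum of terms each bounded by `δ` in modulus is bounded by `card² · δ`. -/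
theorem abs_sum_sum_le_card_sq_mul {ι : Type*} [Fintype ι] {t : ι → ι → ℝ} {δ : ℝ}
    (h : ∀ x y, |t x y| ≤ δ) :
    |∑ x, ∑ y, t x y| ≤ (Fintype.card ι : ℝ) ^ 2 * δ := by
  calc |∑ x, ∑ y, t x y| ≤ ∑ x, |∑ y, t x y| := Finset.abs_sum_le_sum_abs _ _
    _ ≤ ∑ x, ∑ y, |t x y| := Finset.sum_le_sum fun x _ => Finset.abs_sum_le_sum_abs _ _
    _ ≤ ∑ _x, ∑ _y, δ := Finset.sum_le_sum fun x _ => Finset.sum_le_sum fun y _ => h x y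
    _ = (Fintype.card ι : ℝ) ^ 2 * δ := by
        rw [Finset.sum_const, Finset.sum_const, Finset.card_univ, nsmul_eq_mul, nsmul_eq_mul]
        ring

/-- **THE ERROR-BAR ORACLE: THE VARIANCE OF THE VOLUME-AVERAGED PLAQUETTE IS `v(β)/L²` UP TO `r^{L²−2}`.**
For `β > 0` and `L ≥ 2`, under theory-2's Wilson measure on `(ℤ/L)²`, with
`P̄ = (Σ_x ½ tr U_x)/L²`, `Var(P̄) = ⟨P̄²⟩ − ⟨P̄⟩²`, `r = I₂(2β)/I₁(2β)` and
`v(β) = ¼(1 + 3 I₃(2β)/I₁(2β)) − r²` (the infinite-volume single-plaquette variance):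
`|Var(P̄) − v(β)/L²| ≤ r^{L²−2}·(15/16 + (29/4) Σ_n I_{n+2}(2β)/I₁(2β))`. -/
theorem abs_variance_su2a0_plaquetteAverage_two_sub_le {L : ℕ} [NeZero L] {β : ℝ} (hβ : 0 < β)
    (hL : 2 ≤ L) :
    |(∫ V, ((∑ x : Site 2 L, su2a0 (plaquetteHolonomy V x 0 1)) / ((L ^ 2 : ℕ) : ℝ)) ^ 2
          ∂(wilsonMeasure (d := 2) (L := L) (fundamentalRep (Fin 2)) β) -
        (∫ V, (∑ x : Site 2 L, su2a0 (plaquetteHolonomy V x 0 1)) / ((L ^ 2 : ℕ) : ℝ)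
          ∂(wilsonMeasure (d := 2) (L := L) (fundamentalRep (Fin 2)) β)) ^ 2) -
        (1 / 4 * (1 + 3 * (besselI 3 (2 * β) / besselI 1 (2 * β))) -
          (besselI 2 (2 * β) / besselI 1 (2 * β)) ^ 2) / ((L ^ 2 : ℕ) : ℝ)| ≤
      (besselI 2 (2 * β) / besselI 1 (2 * β)) ^ (L ^ 2 - 2) *
        (15 / 16 + 29 / 4 * (∑' n : ℕ, besselI (n + 2) (2 * β)) / besselI 1 (2 * β)) := by
  haveI := secondCountableTopology_su2
  set μ := wilsonMeasure (d := 2) (L := L) (fundamentalRep (Fin 2)) β with hμ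
  haveI : IsProbabilityMeasure μ :=
    isProbabilityMeasure_wilsonMeasure (d := 2) (L := L) (fundamentalRep (Fin 2)) (continuous_fundamentalRep _) β
  obtain ⟨hr0, hr1⟩ := besselI_two_div_one_lt_one hβ
  set r : ℝ := besselI 2 (2 * β) / besselI 1 (2 * β) with hr
  set S : ℝ := (∑' n : ℕ, besselI (n + 2) (2 * β)) / besselI 1 (2 * β) with hS
  set v : ℝ := 1 / 4 * (1 + 3 * (besselI 3 (2 * β) / besselI 1 (2 * β))) - r ^ 2 with hv
  set c : ℝ := ((L ^ 2 : ℕ) : ℝ) with hc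
  have hS0 : 0 ≤ S := div_nonneg (tsum_nonneg fun n => besselI_nonneg _ (by linarith))
    (besselI_pos 1 (by linarith)).le
  have hcard : (Fintype.card (Site 2 L) : ℝ) = c := by rw [hc, Flux.card_site_two]
  have hc0 : 0 < c := by rw [hc]; positivity
  -- the plaquette traces and their integrability
  set f : Site 2 L → GaugeConfig 2 L (Matrix.specialUnitaryGroup (Fin 2) ℂ) → ℝ :=
    fun x V => su2a0 (plaquetteHolonomy V x 0 1) with hf
  have hfc : ∀ x, Continuous (f x) := fun x =>
    continuous_su2a0.comp (by unfold plaquetteHolonomy; fun_prop)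
  have hfb : ∀ x V, |f x V| ≤ 1 := fun x V => abs_su2a0_le_one _
  have hfi : ∀ x, Integrable (f x) μ := fun x =>
    (integrable_const (1 : ℝ)).mono' (hfc x).measurable.aestronglyMeasurable
      (ae_of_all _ fun V => by rw [Real.norm_eq_abs]; exact hfb x V)
  have hffi : ∀ x y, Integrable (fun V => f x V * f y V) μ := fun x y =>
    (integrable_const (1 : ℝ)).mono' ((hfc x).mul (hfc y)).measurable.aestronglyMeasurable
      (ae_of_all _ fun V => by
        rw [Real.norm_eq_abs, abs_mul]
        exact mul_le_one₀ (hfb x V) (abs_nonneg _) (hfb y V))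
  -- first and second moments of `P̄` as sums
  set E : Site 2 L → ℝ := fun x => ∫ V, f x V ∂μ with hE
  set M : Site 2 L → Site 2 L → ℝ := fun x y => ∫ V, f x V * f y V ∂μ with hM
  have hmean : ∫ V, (∑ x, f x V) / c ∂μ = (∑ x, E x) / c := by
    rw [integral_div, integral_finsetSum _ (fun x _ => hfi x)]
  have hsq : ∫ V, ((∑ x, f x V) / c) ^ 2 ∂μ = (∑ x, ∑ y, M x y) / c ^ 2 := by
    have h1 : ∀ V, ((∑ x, f x V) / c) ^ 2 = (∑ x, ∑ y, f x V * f y V) / c ^ 2 := fun V => by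
      rw [div_pow, sq, Finset.sum_mul_sum]
    simp_rw [h1]
    rw [integral_div, integral_finsetSum _ (fun x _ => integrable_finsetSum _ (fun y _ => hffi x y))]
    congr 1
    exact Finset.sum_congr rfl fun x _ => integral_finsetSum _ (fun y _ => hffi x y)
  -- the variance minus `v/c` as a double sum of small terms
  have hkey : (∫ V, ((∑ x, f x V) / c) ^ 2 ∂μ - (∫ V, (∑ x, f x V) / c ∂μ) ^ 2) - v / c =
      (∑ x, ∑ y, (M x y - E x * E y - if x = y then v else 0)) / c ^ 2 := by
    rw [hsq, hmean]
    have hsum : ∑ x, ∑ y, (M x y - E x * E y - if x = y then v else 0) =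
        ∑ x, ∑ y, M x y - (∑ x, E x) * (∑ y, E y) - c * v := by
      simp only [Finset.sum_sub_distrib]
      rw [Finset.sum_mul_sum]
      congr 1
      have : ∀ x : Site 2 L, (∑ y, if x = y then v else 0) = v := fun x => by
        rw [Finset.sum_ite_eq]; simp
      simp_rw [this]
      rw [Finset.sum_const, Finset.card_univ, nsmul_eq_mul, hcard]
    rw [hsum]
    have hc0' : c ≠ 0 := hc0.ne'
    field_simp
  -- each term is small
  have hδ : ∀ x y : Site 2 L, |M x y - E x * E y - if x = y then v else 0| ≤
      r ^ (L ^ 2 - 2) * (15 / 16 + 29 / 4 * S) := by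
    intro x y
    have hrr : r ^ (L ^ 2 - 1) ≤ r ^ (L ^ 2 - 2) := pow_le_pow_of_le_one hr0 hr1.le (by omega)
    have hm : 0 ≤ r ^ (L ^ 2 - 2) := pow_nonneg hr0 _
    by_cases hxy : x = y
    · subst hxy
      rw [if_pos rfl]
      have h := abs_variance_su2a0_plaquette_two_sub_le (L := L) hβ x
      have h' : 29 / 4 * (∑' n : ℕ, besselI (n + 2) (2 * β)) / besselI 1 (2 * β) = 29 / 4 * S := by
        rw [hS, mul_div_assoc]
      rw [h', ← hr] at h
      have hEq : M x x - E x * E x - v = (M x x - E x ^ 2) - (1 / 4 * (1 + 3 * (besselI 3 (2 * β) /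
          besselI 1 (2 * β))) - r ^ 2) := by rw [hv]; ring
      rw [hEq]
      calc _ ≤ r ^ (L ^ 2 - 1) * (7 / 12 + 29 / 4 * S) := h
        _ ≤ r ^ (L ^ 2 - 2) * (7 / 12 + 29 / 4 * S) := mul_le_mul_of_nonneg_right hrr (by positivity)
        _ ≤ r ^ (L ^ 2 - 2) * (15 / 16 + 29 / 4 * S) := mul_le_mul_of_nonneg_left (by linarith) hm
    · rw [if_neg hxy, sub_zero]
      have h := abs_covariance_su2a0_plaquette_two_le (L := L) hβ hxy
      have h' : 101 / 16 * (∑' n : ℕ, besselI (n + 2) (2 * β)) / besselI 1 (2 * β) = 101 / 16 * S := by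
        rw [hS, mul_div_assoc]
      rw [h', ← hr] at h
      calc _ ≤ r ^ (L ^ 2 - 2) * (15 / 16 + 101 / 16 * S) := h
        _ ≤ r ^ (L ^ 2 - 2) * (15 / 16 + 29 / 4 * S) := mul_le_mul_of_nonneg_left (by linarith) hm
  -- assemble
  have h29 : 29 / 4 * (∑' n : ℕ, besselI (n + 2) (2 * β)) / besselI 1 (2 * β) = 29 / 4 * S := by
    rw [hS, mul_div_assoc]
  rw [h29]
  show |(∫ V, ((∑ x, f x V) / c) ^ 2 ∂μ - (∫ V, (∑ x, f x V) / c ∂μ) ^ 2) - v / c| ≤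
      r ^ (L ^ 2 - 2) * (15 / 16 + 29 / 4 * S)
  rw [hkey, abs_div, abs_of_pos (pow_pos hc0 2), div_le_iff₀ (pow_pos hc0 2)]
  have h := abs_sum_sum_le_card_sq_mul hδ
  rw [hcard] at h
  linarith

/-- **`L²·Var(P̄) → v(β)`**: the volume-averaged plaquette of the `(L+2) × (L+2)` torus has variance
`v(β)/(L+2)² (1 + o(1))` — to leading order the `L²` plaquettes are independent, identically distributed with
the one-plaquette variance `v(β) = ¼(1 + 3 I₃(2β)/I₁(2β)) − (I₂(2β)/I₁(2β))²`. -/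
theorem tendsto_sq_mul_variance_su2a0_plaquetteAverage_two {β : ℝ} (hβ : 0 < β) :
    Tendsto (fun L : ℕ => (((L + 2) ^ 2 : ℕ) : ℝ) *
        (∫ V, ((∑ x : Site 2 (L + 2), su2a0 (plaquetteHolonomy V x 0 1)) / (((L + 2) ^ 2 : ℕ) : ℝ)) ^ 2
            ∂(wilsonMeasure (d := 2) (L := L + 2) (fundamentalRep (Fin 2)) β) -
          (∫ V, (∑ x : Site 2 (L + 2), su2a0 (plaquetteHolonomy V x 0 1)) / (((L + 2) ^ 2 : ℕ) : ℝ)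
            ∂(wilsonMeasure (d := 2) (L := L + 2) (fundamentalRep (Fin 2)) β)) ^ 2))
      atTop (𝓝 (1 / 4 * (1 + 3 * (besselI 3 (2 * β) / besselI 1 (2 * β))) -
        (besselI 2 (2 * β) / besselI 1 (2 * β)) ^ 2)) := by
  obtain ⟨hr0, hr1⟩ := besselI_two_div_one_lt_one hβ
  set r : ℝ := besselI 2 (2 * β) / besselI 1 (2 * β) with hr
  set K : ℝ := 15 / 16 + 29 / 4 * (∑' n : ℕ, besselI (n + 2) (2 * β)) / besselI 1 (2 * β) with hK
  set v : ℝ := 1 / 4 * (1 + 3 * (besselI 3 (2 * β) / besselI 1 (2 * β))) - r ^ 2 with hv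
  have hK0 : 0 ≤ K := by
    have : 0 ≤ (∑' n : ℕ, besselI (n + 2) (2 * β)) / besselI 1 (2 * β) :=
      div_nonneg (tsum_nonneg fun n => besselI_nonneg _ (by linarith)) (besselI_pos 1 (by linarith)).le
    rw [hK, mul_div_assoc]; positivity
  -- `(L+2)² r^{(L+2)² − 2} ≤ (L+2)² r^{L+2} → 0`
  have habs : |r| < 1 := by rw [abs_of_nonneg hr0]; exact hr1
  have hgeo : Tendsto (fun n : ℕ => (n : ℝ) ^ 2 * r ^ n) atTop (𝓝 0) :=
    tendsto_pow_const_mul_const_pow_of_abs_lt_one 2 habs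
  have hgeo2 : Tendsto (fun L : ℕ => ((L + 2 : ℕ) : ℝ) ^ 2 * r ^ (L + 2)) atTop (𝓝 0) :=
    hgeo.comp (tendsto_add_atTop_nat 2)
  have hbound : Tendsto (fun L : ℕ => ((L + 2 : ℕ) : ℝ) ^ 2 * r ^ (L + 2) * K) atTop (𝓝 0) := by
    simpa using hgeo2.mul_const K
  rw [tendsto_iff_norm_sub_tendsto_zero]
  refine squeeze_zero (fun L => norm_nonneg _) (fun L => ?_) hbound
  rw [Real.norm_eq_abs]
  have hL : 2 ≤ L + 2 := by omega
  have h := abs_variance_su2a0_plaquetteAverage_two_sub_le (L := L + 2) hβ hL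
  have hc : (0 : ℝ) < (((L + 2) ^ 2 : ℕ) : ℝ) := by positivity
  have hcast : (((L + 2) ^ 2 : ℕ) : ℝ) = ((L + 2 : ℕ) : ℝ) ^ 2 := by push_cast; ring
  -- `c·|Var − v/c| = |c·Var − v|`
  have hmul := mul_le_mul_of_nonneg_left h hc.le
  rw [← abs_of_pos hc, ← abs_mul, abs_of_pos hc, mul_sub, mul_div_cancel₀ _ hc.ne'] at hmul
  refine hmul.trans ?_
  -- `r^{(L+2)²−2} ≤ r^{L+2}`
  have hexp : L + 2 ≤ (L + 2) ^ 2 - 2 := by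
    have h2 : (L + 2) ^ 2 = (L + 2) * (L + 2) := sq _
    have h3 : L + 2 + 2 ≤ (L + 2) * (L + 2) := by nlinarith
    omega
  have hpow : r ^ ((L + 2) ^ 2 - 2) ≤ r ^ (L + 2) := pow_le_pow_of_le_one hr0 hr1.le hexp
  rw [hcast]
  have := mul_le_mul_of_nonneg_left (mul_le_mul_of_nonneg_right hpow hK0) (sq_nonneg (((L + 2 : ℕ) : ℝ)))
  calc ((L + 2 : ℕ) : ℝ) ^ 2 * (r ^ ((L + 2) ^ 2 - 2) * (15 / 16 + 29 / 4 * (∑' n : ℕ, besselI (n + 2) (2 * β)) /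
        besselI 1 (2 * β))) ≤ ((L + 2 : ℕ) : ℝ) ^ 2 * (r ^ (L + 2) * K) := this
    _ = ((L + 2 : ℕ) : ℝ) ^ 2 * r ^ (L + 2) * K := by ring

end Summit.Ventures.LatticeQCDFlow.Scoring
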